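import Summits.PneNP.PneNP.Theorems.SymmetryBudgetNoHiddenOrderDecodeDefs
import Summits.PneNP.PneNP.Theorems.SymmetryBudgetNoHiddenOrderValueGadgets
import Summits.PneNP.PneNP.Theorems.SymmetryBudgetNoHiddenOrderDecodeWalkInv
import Summits.PneNP.PneNP.Theorems.SymmetryBudgetNoHiddenOrderKitBridgesSelect
import Summits.PneNP.PneNP.Theorems.SymmetryBudgetNoHiddenOrderReplayIter

/-!
# `NoHiddenOrder` (stmt-PneNP-14781), (R2c) value layer IV: semantics of the analysis of a walk state

Route `PneNP/SymmetryBudget`; definitions in `SymmetryBudgetNoHiddenOrderDecodeDefs.lean`.  If the input wires of a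
`DAnalysis` read the walk state `S` of the label `L = ⟨U, X, λ⟩` (block, one-hot colour values `< D`, consumed set,
dead flag) and the adjacency wires read `G` (`|V|² ≤ N`, `|V| ≤ T`), then: `O.lt`/`O.eq` read the order/kernel of the
colouring, `C.R.r (Fin.last T) u w` reads `u ∈ A ∧ w ∈ swReach G A col u`, `isAND` reads `IsAND G S`, `big2` reads
`2 ≤ |A|`, `stop` reads `Stop L S`, `frozen` reads `S.dead ∨ Stop L S`, `andok` reads `AndOK G L S`; and, when the
switching graph is connected inside the block and the colouring is equitable there (the situation of an OR-step under
the walk invariant), `M.sel`, `cand`, `dom`, `go` read the first smallest cell, the candidates `cands L S`, `Dom L S` and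
`∃ y, Dom L S y` (each guarded by `2 ≤ |A|`).  Sorry-free; supports stmt-PneNP-14781.
-/

set_option linter.dupNamespace false -- `Summit.PneNP.PneNP.…` (D-0017 single-conjunct layout)

namespace Summit.PneNP.PneNP.Theorems

open Finset Literature.Computability.Complexity Literature.Computability.Complexity.SymProg CGBits CGBits.WState

namespace DAnalysis

variable {ι Λ : Type*} [DecidableEq ι] [DecidableEq Λ] {P : SymProg ι Λ}
variable {V : Type*} [Fintype V] [DecidableEq V] {N T D : ℕ} {U X : Finset V} {lam : V → ℕ}
variable {Da : DAnalysis P V N T D U X lam} {x : ι → Bool}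
variable {G : SimpleGraph V} [DecidableRel G.Adj] {S : WState V}

/-- The label analysed. [folklore] -/
abbrev lab (_Da : DAnalysis P V N T D U X lam) : CertifiedLabels.Label V := ⟨U, X, lam⟩

/-- The hypotheses of the stage: the wires read `S`, adjacency reads `G`, colours are `< D`, the bounds. -/
structure Hyp (Da : DAnalysis P V N T D U X lam) (x : ι → Bool) (G : SimpleGraph V) (S : WState V) : Prop where
  /-- the input wires read the state -/
  reads : Da.Reads x S
  /-- adjacency -/
  adj_iff : ∀ a b, wval x (P.sem x) (Da.adj a b) = true ↔ G.Adj a b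
  /-- colours are below `D` -/
  col_lt : ∀ v, S.col v < D
  /-- count bound -/
  hN : Fintype.card V ^ 2 ≤ N
  /-- round bound -/
  hT : Fintype.card V ≤ T

variable (h : Da.Hyp x G S)
include h

omit [DecidableRel G.Adj] in
/-- Block sizes against the bounds. [folklore] -/
theorem card_le_N (A : Finset V) : A.card ≤ N :=
  ((card_le_univ A).trans (Nat.le_self_pow two_ne_zero _)).trans h.hN

omit [DecidableRel G.Adj] in
/-- Block sizes against the bounds, squared. [folklore] -/
theorem card_sq_le_N (A : Finset V) : A.card ^ 2 ≤ N :=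
  (Nat.pow_le_pow_left (card_le_univ A) 2).trans h.hN

/-! ### Negations, order, kernel -/

omit [DecidableRel G.Adj] in
/-- `nmem`. [folklore] -/
theorem sem_nmem (v : V) : P.sem x (Da.nmem v) = true ↔ v ∉ S.A := by
  rw [P.sem_nor_singleton (Da.kind_nmem v) (Da.srcs_nmem v), Bool.not_eq_true', ← Bool.not_eq_true, h.reads.mem_iff]

omit [DecidableRel G.Adj] in
/-- `ncons`. [folklore] -/
theorem sem_ncons (v : V) : P.sem x (Da.ncons v) = true ↔ v ∉ S.C := by
  rw [P.sem_nor_singleton (Da.kind_ncons v) (Da.srcs_ncons v), Bool.not_eq_true', ← Bool.not_eq_true, h.reads.cons_iff]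

omit [DecidableRel G.Adj] in
/-- **The order wires read the order of the colouring.** [folklore] -/
theorem sem_lt_iff (u v : V) : P.sem x (Da.O.lt u v) = true ↔ S.col u < S.col v :=
  Da.O.sem_lt_iff (fun u c => by rw [Da.O_val]; exact h.reads.val_iff u c) h.col_lt u v

omit [DecidableRel G.Adj] in
/-- **The kernel wires read the kernel of the colouring.** [folklore] -/
theorem sem_eq_iff (u v : V) : P.sem x (Da.O.eq u v) = true ↔ S.col u = S.col v :=
  Da.O.sem_eq_iff (fun u c => by rw [Da.O_val]; exact h.reads.val_iff u c) h.col_lt u v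

/-! ### Components and the section test -/

/-- **Reachability reads the switching components of the block.** [folklore] -/
theorem sem_reach_iff (u w : V) :
    P.sem x (Da.C.R.r (Fin.last T) u w) = true ↔ u ∈ S.A ∧ w ∈ BranchSum.swReach G S.A S.col u :=
  Da.C.sem_r_iff_swReach (fun u => by rw [Da.CS_mem]; exact h.reads.mem_iff u)
    (fun a b => by rw [Da.CS_adj]; exact h.adj_iff a b)
    (fun a _ b _ => by rw [Da.CS_eq, wval_inr]; exact sem_eq_iff h a b)
    (card_sq_le_N h _) ((card_le_univ _).trans h.hT) u w

/-- `all u`: the component of `u` is the whole block (for `u` in the block). [folklore] -/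
theorem sem_all_iff {u : V} (hu : u ∈ S.A) : P.sem x (Da.all u) = true ↔ BranchSum.swReach G S.A S.col u = S.A := by
  rw [P.sem_and (Da.kind_all u), Da.srcs_all]
  simp only [mem_image, mem_univ, true_and, forall_exists_index, forall_apply_eq_imp_iff, wval_inr]
  have hcov : ∀ w, P.sem x (Da.cov u w) = true ↔ (w ∈ S.A → w ∈ BranchSum.swReach G S.A S.col u) := by
    intro w
    rw [P.sem_or (Da.kind_cov u w), Da.srcs_cov]
    simp only [mem_insert, mem_singleton, exists_eq_or_imp, exists_eq_left, wval_inr, sem_nmem h, sem_reach_iff h]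
    tauto
  simp only [hcov]
  constructor
  · intro H
    exact Subset.antisymm (BranchSum.swReach_subset _ _ _) fun w hw => H w hw
  · intro H w hw; rw [H]; exact hw

/-- **`isAND` reads the section condition.** [folklore] -/
theorem sem_isAND_iff : P.sem x Da.isAND = true ↔ IsAND G S := by
  rw [P.sem_or Da.kind_isAND, Da.srcs_isAND]
  simp only [mem_image, mem_univ, true_and, exists_exists_eq_and, wval_inr]
  unfold IsAND
  constructor
  · rintro ⟨u, hu⟩
    rw [P.sem_and (Da.kind_disc u), Da.srcs_disc] at hu
    simp only [mem_insert, mem_singleton, forall_eq_or_imp, forall_eq, h.reads.mem_iff, wval_inr,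
      P.sem_nor_singleton (Da.kind_nall u) (Da.srcs_nall u), Bool.not_eq_true'] at hu
    refine ⟨u, hu.1, fun heq => ?_⟩
    have := (sem_all_iff h hu.1).2 heq
    rw [this] at hu
    exact Bool.noConfusion hu.2
  · rintro ⟨u, hu, hne⟩
    refine ⟨u, ?_⟩
    rw [P.sem_and (Da.kind_disc u), Da.srcs_disc]
    simp only [mem_insert, mem_singleton, forall_eq_or_imp, forall_eq, h.reads.mem_iff, wval_inr,
      P.sem_nor_singleton (Da.kind_nall u) (Da.srcs_nall u), Bool.not_eq_true']
    refine ⟨hu, ?_⟩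
    cases hs : P.sem x (Da.all u)
    · rfl
    · exact absurd ((sem_all_iff h hu).1 hs) hne

/-- `nisAND`. [folklore] -/
theorem sem_nisAND_iff : P.sem x Da.nisAND = true ↔ ¬ IsAND G S := by
  rw [P.sem_nor_singleton Da.kind_nisAND Da.srcs_nisAND, wval_inr, Bool.not_eq_true', ← Bool.not_eq_true, sem_isAND_iff h]

omit [DecidableRel G.Adj] in
/-- **`big2` reads `2 ≤ |block|`.** [folklore] -/
theorem sem_big2_iff : P.sem x Da.big2 = true ↔ 2 ≤ S.A.card := by
  rw [P.sem_atLeast_trueCount Da.kind_big2 Da.srcs_big2]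
  unfold SymProg.trueCount
  rw [filter_image, card_image_of_injective _ Da.mem_injective]
  have : (univ.filter fun u => wval x (P.sem x) (Da.mem u) = true) = S.A := by
    ext u; simp only [mem_filter, mem_univ, true_and, h.reads.mem_iff]
  rw [this]

omit [DecidableRel G.Adj] in
/-- `nbig2`. [folklore] -/
theorem sem_nbig2_iff : P.sem x Da.nbig2 = true ↔ ¬ 2 ≤ S.A.card := by
  rw [P.sem_nor_singleton Da.kind_nbig2 Da.srcs_nbig2, wval_inr, Bool.not_eq_true', ← Bool.not_eq_true, sem_big2_iff h]

/-- **`isOR` reads "connected with at least two vertices".** [folklore] -/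
theorem sem_isOR_iff : P.sem x Da.isOR = true ↔ ¬ IsAND G S ∧ 2 ≤ S.A.card := by
  rw [P.sem_and Da.kind_isOR, Da.srcs_isOR]
  simp only [mem_insert, mem_singleton, forall_eq_or_imp, forall_eq, wval_inr, sem_nisAND_iff h, sem_big2_iff h]

/-! ### Stop, frozen, the AND-test -/

omit [DecidableRel G.Adj] in
/-- **`stop` reads the stop condition of the label.** [folklore] -/
theorem sem_stop_iff : P.sem x Da.stop = true ↔ Stop (lab Da) S := by
  rw [P.sem_and Da.kind_stop, Da.srcs_stop]
  simp only [mem_union, mem_image, mem_sdiff, mem_univ, true_and]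
  unfold Stop
  constructor
  · intro H
    have hm : ∀ v ∈ U, v ∈ S.A := fun v hv => (h.reads.mem_iff v).1 (H _ (Or.inl (Or.inl ⟨v, hv, rfl⟩)))
    have hnm : ∀ v ∉ U, v ∉ S.A := fun v hv => (sem_nmem h v).1 (H _ (Or.inl (Or.inr ⟨v, hv, rfl⟩)))
    have hc : ∀ v ∈ X, v ∈ S.C := fun v hv => (h.reads.cons_iff v).1 (H _ (Or.inr (Or.inl ⟨v, hv, rfl⟩)))
    have hnc : ∀ v ∉ X, v ∉ S.C := fun v hv => (sem_ncons h v).1 (H _ (Or.inr (Or.inr ⟨v, hv, rfl⟩)))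
    refine ⟨?_, ?_⟩
    · ext v; by_cases hv : v ∈ U
      · exact ⟨fun _ => hv, fun _ => hm v hv⟩
      · exact ⟨fun hvA => absurd hvA (hnm v hv), fun hvU => absurd hvU hv⟩
    · ext v; by_cases hv : v ∈ X
      · exact ⟨fun _ => hv, fun _ => hc v hv⟩
      · exact ⟨fun hvC => absurd hvC (hnc v hv), fun hvX => absurd hvX hv⟩
  · rintro ⟨hA, hC⟩ w hw
    rcases hw with (⟨v, hv, rfl⟩ | ⟨v, hv, rfl⟩) | (⟨v, hv, rfl⟩ | ⟨v, hv, rfl⟩)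
    · rw [h.reads.mem_iff, hA]; exact hv
    · rw [wval_inr, sem_nmem h, hA]; exact hv
    · rw [h.reads.cons_iff, hC]; exact hv
    · rw [wval_inr, sem_ncons h, hC]; exact hv

omit [DecidableRel G.Adj] in
/-- **`frozen` reads "dead or stopped".** [folklore] -/
theorem sem_frozen_iff : P.sem x Da.frozen = true ↔ S.dead = true ∨ Stop (lab Da) S := by
  rw [P.sem_or Da.kind_frozen, Da.srcs_frozen]
  simp only [mem_insert, mem_singleton, exists_eq_or_imp, exists_eq_left, h.reads.dead_iff, wval_inr, sem_stop_iff h]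

omit [DecidableRel G.Adj] in
/-- `nfrozen`. [folklore] -/
theorem sem_nfrozen_iff : P.sem x Da.nfrozen = true ↔ ¬ (S.dead = true ∨ Stop (lab Da) S) := by
  rw [P.sem_nor_singleton Da.kind_nfrozen Da.srcs_nfrozen, wval_inr, Bool.not_eq_true', ← Bool.not_eq_true,
    sem_frozen_iff h]

/-- **`andok` reads the AND-test of the walk.** [folklore] -/
theorem sem_andok_iff : P.sem x Da.andok = true ↔ AndOK G (lab Da) S := by
  unfold AndOK
  by_cases hU : U.Nonempty
  · have hk : P.kind Da.andok = Kind.and := by rw [Da.kind_andok, if_pos hU]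
    rw [P.sem_and hk, Da.srcs_andok, if_pos hU]
    simp only [mem_image, mem_product, Prod.exists, forall_exists_index, and_imp]
    constructor
    · intro H
      refine ⟨hU, fun u hu u' hu' => ?_⟩
      have := H _ u u' hu hu' rfl
      rw [wval_inr, sem_reach_iff h] at this
      exact this.2
    · rintro ⟨-, H⟩ _ u u' hu hu' rfl
      rw [wval_inr, sem_reach_iff h]
      exact ⟨BranchSum.swReach_subset _ _ _ (H u hu u hu), H u hu u' hu'⟩
  · have hk : P.kind Da.andok = Kind.or := by rw [Da.kind_andok, if_neg hU]
    rw [P.sem_or hk, Da.srcs_andok, if_neg hU]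
    simp only [notMem_empty, false_and, exists_false, false_iff, not_and]
    exact fun h' => absurd h' hU

/-- `nandok`. [folklore] -/
theorem sem_nandok_iff : P.sem x Da.nandok = true ↔ ¬ AndOK G (lab Da) S := by
  rw [P.sem_nor_singleton Da.kind_nandok Da.srcs_nandok, wval_inr, Bool.not_eq_true', ← Bool.not_eq_true, sem_andok_iff h]

/-! ### The first smallest cell and the OR-choice -/

omit [Fintype V] h in
/-- Connectedness in `swReach` form gives the cut form. [folklore] -/
theorem connIn_of_forall_swReach {A : Finset V} {c : V → ℕ} (hconn : ∀ u ∈ A, BranchSum.swReach G A c u = A) :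
    ConnIn G A c := by
  intro S' hS' hne hneq
  obtain ⟨v, hv⟩ := hne
  have hvA : v ∈ A := hS' hv
  have hnot : ¬ BranchSum.swReach G A c v ⊆ S' := fun hsub => hneq (Subset.antisymm hS' (hconn v hvA ▸ hsub))
  obtain ⟨a, ha, b, hb, hab⟩ := BranchSum.swReach_cut (G := G) c hv hnot
  refine ⟨a, (mem_inter.1 ha).1, b, mem_sdiff.2 ⟨?_, (mem_sdiff.1 hb).2⟩, hab⟩
  exact BranchSum.swReach_subset _ _ _ (mem_sdiff.1 hb).1

omit [Fintype V] h in
/-- Under the walk invariant at a connected state, the `ReplayIter`-style hypothesis holds. [folklore] -/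
theorem inv_of_winv {n : ℕ} (hW : WInv G n S) (hA : ¬ IsAND G S) : 2 ≤ S.A.card → EqIn G S.A S.col ∧ ConnIn G S.A S.col := by
  intro _
  refine ⟨hW.eqIn, connIn_of_forall_swReach fun u hu => ?_⟩
  by_contra hne
  exact hA ⟨u, hu, hne⟩

omit [DecidableRel G.Adj] in
/-- The part of the `MinCell` gadget is the block. [folklore] -/
theorem part_M : Da.M.part x = S.A := by
  ext u; unfold MinCell.part MinCell.Mem
  simp only [mem_filter, mem_univ, true_and, Da.M_mem]
  exact h.reads.mem_iff u

omit [DecidableRel G.Adj] in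
/-- The `MinCell` gadget reads the colouring of the block. [folklore] -/
theorem reads_M : Da.M.Reads x (fun a : Da.M.part x => S.col a) where
  eq_iff a b := by rw [Da.M_eq, wval_inr]; exact sem_eq_iff h a b
  lt_iff a b := by rw [Da.M_lt, wval_inr]; exact sem_lt_iff h a b

/-- **`M.sel a`** reads "`|A| ≥ 2` and `a` lies in the first smallest cell", at a connected equitable state.
[folklore] -/
theorem sem_sel_iff (hinv : 2 ≤ S.A.card → EqIn G S.A S.col ∧ ConnIn G S.A S.col) {a : V} (ha : a ∈ S.A) :
    P.sem x (Da.M.sel a) = true ↔ 2 ≤ S.A.card ∧ a ∈ BranchSum.smallestCell S.A S.col := by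
  have hpart := part_M h
  have ha' : a ∈ Da.M.part x := hpart ▸ ha
  rw [MinCell.sem_sel_iff (reads_M h) (by rw [hpart]; exact card_le_N h _) ⟨a, ha'⟩]
  simp only [← ReplayIter.card_cellOf_eq_cellCard', hpart]
  have hq : (∀ b : Da.M.part x, 2 ≤ (BranchSum.cellOf S.A S.col b).card →
      (BranchSum.cellOf S.A S.col a).card < (BranchSum.cellOf S.A S.col b).card ∨
        ((BranchSum.cellOf S.A S.col a).card = (BranchSum.cellOf S.A S.col b).card ∧ S.col a ≤ S.col b)) ↔
      ∀ b ∈ S.A, 2 ≤ (BranchSum.cellOf S.A S.col b).card →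
        (BranchSum.cellOf S.A S.col a).card < (BranchSum.cellOf S.A S.col b).card ∨
          ((BranchSum.cellOf S.A S.col a).card = (BranchSum.cellOf S.A S.col b).card ∧ S.col a ≤ S.col b) :=
    ⟨fun H b hb => H ⟨b, hpart ▸ hb⟩, fun H b => H b (hpart ▸ b.2)⟩
  rw [hq]
  by_cases hA : 2 ≤ S.A.card
  · obtain ⟨heq, hconn⟩ := hinv hA
    have hbig : ∀ b ∈ S.A, 2 ≤ (BranchSum.cellOf S.A S.col b).card :=
      fun b hb => BranchSum.two_le_card_cellOf (G := G) heq hconn hA hb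
    rw [← BranchSum.mem_smallestCell_iff_minCell S.col hbig ha]
    simp [hA]
  · have hsmall : (BranchSum.cellOf S.A S.col a).card < 2 :=
      lt_of_le_of_lt (card_le_card (filter_subset _ _)) (not_le.1 hA)
    constructor
    · rintro ⟨h2, -⟩; omega
    · rintro ⟨h2, -⟩; exact absurd h2 hA

/-- **`cand y`** reads "`|A| ≥ 2` and `y` is a candidate of the OR-choice". [folklore] -/
theorem sem_cand_iff (hinv : 2 ≤ S.A.card → EqIn G S.A S.col ∧ ConnIn G S.A S.col) (y : V) :
    P.sem x (Da.cand y) = true ↔ 2 ≤ S.A.card ∧ y ∈ cands (lab Da) S := by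
  unfold cands
  by_cases hyX : y ∈ X
  · have hk : P.kind (Da.cand y) = Kind.and := by rw [Da.kind_cand, if_pos hyX]
    rw [P.sem_and hk, Da.srcs_cand, if_pos hyX]
    simp only [mem_insert, mem_singleton, forall_eq_or_imp, forall_eq, h.reads.mem_iff, wval_inr, sem_ncons h,
      mem_filter]
    constructor
    · rintro ⟨hyA, hsel, hyC⟩
      obtain ⟨hA, hy⟩ := (sem_sel_iff h hinv hyA).1 hsel
      exact ⟨hA, hy, hyX, hyC⟩
    · rintro ⟨hA, hy, -, hyC⟩
      have hyA := BranchSum.smallestCell_subset _ _ hy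
      exact ⟨hyA, (sem_sel_iff h hinv hyA).2 ⟨hA, hy⟩, hyC⟩
  · have hk : P.kind (Da.cand y) = Kind.or := by rw [Da.kind_cand, if_neg hyX]
    rw [P.sem_or hk, Da.srcs_cand, if_neg hyX]
    simp only [notMem_empty, false_and, exists_false, false_iff, mem_filter, not_and]
    exact fun _ _ hy' => absurd hy' hyX

/-- `ncand y`. [folklore] -/
theorem sem_ncand_iff (hinv : 2 ≤ S.A.card → EqIn G S.A S.col ∧ ConnIn G S.A S.col) (y : V) :
    P.sem x (Da.ncand y) = true ↔ ¬ (2 ≤ S.A.card ∧ y ∈ cands (lab Da) S) := by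
  rw [P.sem_nor_singleton (Da.kind_ncand y) (Da.srcs_ncand y), wval_inr, Bool.not_eq_true', ← Bool.not_eq_true,
    sem_cand_iff h hinv]

/-- **`dom y`** reads "`|A| ≥ 2` and `y` dominates". [folklore] -/
theorem sem_dom_iff (hinv : 2 ≤ S.A.card → EqIn G S.A S.col ∧ ConnIn G S.A S.col) (y : V) :
    P.sem x (Da.dom y) = true ↔ 2 ≤ S.A.card ∧ Dom (lab Da) S y := by
  rw [P.sem_and (Da.kind_dom y), Da.srcs_dom]
  simp only [mem_insert, mem_image, mem_filter, forall_eq_or_imp, forall_exists_index, and_imp, wval_inr,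
    sem_cand_iff h hinv]
  unfold Dom
  have hcX : ∀ z, z ∈ cands (lab Da) S → z ∈ X := fun z hz => by
    unfold cands at hz; exact (mem_filter.1 hz).2.1
  constructor
  · rintro ⟨⟨hA, hy⟩, H⟩
    refine ⟨hA, hy, fun z hz hzy => ?_⟩
    by_contra hle
    have := H _ z (hcX z hz) hzy (not_lt.1 hle) rfl
    rw [wval_inr, sem_ncand_iff h hinv] at this
    exact this ⟨hA, hz⟩
  · rintro ⟨hA, hy, H⟩
    refine ⟨⟨hA, hy⟩, ?_⟩
    rintro _ z _ hzy hle rfl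
    rw [wval_inr, sem_ncand_iff h hinv]
    rintro ⟨-, hz⟩
    have := H z hz hzy
    change lam z < lam y at this
    omega

/-- `ndom y`. [folklore] -/
theorem sem_ndom_iff (hinv : 2 ≤ S.A.card → EqIn G S.A S.col ∧ ConnIn G S.A S.col) (y : V) :
    P.sem x (Da.ndom y) = true ↔ ¬ (2 ≤ S.A.card ∧ Dom (lab Da) S y) := by
  rw [P.sem_nor_singleton (Da.kind_ndom y) (Da.srcs_ndom y), wval_inr, Bool.not_eq_true', ← Bool.not_eq_true,
    sem_dom_iff h hinv]

/-- **`go`** reads "`|A| ≥ 2` and some candidate dominates". [folklore] -/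
theorem sem_go_iff (hinv : 2 ≤ S.A.card → EqIn G S.A S.col ∧ ConnIn G S.A S.col) :
    P.sem x Da.go = true ↔ 2 ≤ S.A.card ∧ ∃ y, Dom (lab Da) S y := by
  rw [P.sem_or Da.kind_go, Da.srcs_go]
  simp only [mem_image, exists_exists_and_eq_and, wval_inr, sem_dom_iff h hinv]
  constructor
  · rintro ⟨y, -, hA, hy⟩; exact ⟨hA, y, hy⟩
  · rintro ⟨hA, y, hy⟩
    refine ⟨y, ?_, hA, hy⟩
    have := hy.1
    unfold cands at this
    exact (mem_filter.1 this).2.1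

/-- `ngo`. [folklore] -/
theorem sem_ngo_iff (hinv : 2 ≤ S.A.card → EqIn G S.A S.col ∧ ConnIn G S.A S.col) :
    P.sem x Da.ngo = true ↔ ¬ (2 ≤ S.A.card ∧ ∃ y, Dom (lab Da) S y) := by
  rw [P.sem_nor_singleton Da.kind_ngo Da.srcs_ngo, wval_inr, Bool.not_eq_true', ← Bool.not_eq_true, sem_go_iff h hinv]

/-- The dominating candidate is unique: `dom u` reads `u = y` for the dominating `y`. [folklore] -/
theorem sem_dom_iff_eq (hinv : 2 ≤ S.A.card → EqIn G S.A S.col ∧ ConnIn G S.A S.col) (hA : 2 ≤ S.A.card) {y : V}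
    (hy : Dom (lab Da) S y) (u : V) : P.sem x (Da.dom u) = true ↔ u = y := by
  rw [sem_dom_iff h hinv]
  exact ⟨fun h' => dom_unique h'.2 hy, fun h' => ⟨hA, h' ▸ hy⟩⟩

end DAnalysis

end Summit.PneNP.PneNP.Theorems
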